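import Literature.Analysis.FunctionSpaces.TorusPairDist
import Mathlib.Analysis.SpecialFunctions.SmoothTransition
import Mathlib.Analysis.Calculus.MeanValue
import HarnessLib

/-!
# The cut-off near the hard-core pair tubes on `(ℝ/ℤ)^{N×3}` and its directional Lipschitz modulus

Analysis/FunctionSpaces support file (definitions `IsCutProfile`, `cutProfile`, `smoothCutProfile`,
`pairCutoff`, everything proved; global `volume` convention of `FlatTorus`). The standard device for showing that the `C¹` trial states are a form core of the
hard-core Bose gas (no Lavrentiev gap at the hard core): an `H¹` function vanishing on the tubes
`{ρᵢⱼ ≤ r}` (`ρᵢⱼ = Torus.pairDist i j`, `TorusPairDist`) is multiplied by the product cut-off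

  `χ_δ(t) = ∏_{i<j} θ((ρᵢⱼ(t) - r)/δ)`

(`Torus.pairCutoff θ r δ`) for a **cut profile** `θ` — any `K`-Lipschitz `θ : ℝ → [0, 1]` with
`θ = 0` on `(-∞, 1]` and `θ = 1` on `[2, ∞)` (`Torus.IsCutProfile K θ`); two are provided: the
piecewise linear `Torus.cutProfile u = min 1 (max 0 (u - 1))` (`K = 1`) and the smooth
`Torus.smoothCutProfile u = Real.smoothTransition (u - 1)` (`C^∞`, some `K`), the latter for trial
states that must be `C¹`. The cut-off vanishes where some `ρᵢⱼ ≤ r + δ`, equals `1` where all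
`ρᵢⱼ ≥ r + 2δ`, takes values in `[0, 1]`, and — the input of the Leibniz estimate
`Torus.tsum_sq_mul_enorm_mFourierCoeff_mul_le` (`TorusLipschitzMultiplierH1`) — is Lipschitz along
every coordinate line `𝐞_{(i,k)}` with a modulus supported in the collars of the pairs containing `i`:

  `|χ_δ(t + s𝐞_{(i,k)}) - χ_δ(t)| ≤ (2K|s|/δ) · #{j : r + δ - |s| < ρᵢⱼ(t) < r + 2δ + |s|}`

(`Torus.abs_pairCutoff_add_single_sub_le`): a factor not containing `i` does not move
(`pairDist_add_single_of_ne`), a factor containing `i` moves by at most `K|s|/δ` (`θ` is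
`K`-Lipschitz and `ρᵢⱼ(· + s𝐞_{(i,k)})` is `1`-Lipschitz) and not at all unless `ρᵢⱼ(t)` is within
`|s|` of the transition layer `(r + δ, r + 2δ)`, and `|∏ aₗ - ∏ bₗ| ≤ ∑ |aₗ - bₗ|` for `[0,1]`-valued
factors.

## Mathlib / tree search

Mathlib: `LipschitzWith` API, `Real.smoothTransition` (`C^∞`, `= 0` on `(-∞,0]`, `= 1` on `[1,∞)`),
`lipschitzWith_of_nnnorm_deriv_le`, `Finset.prod_nonneg`, `Finset.prod_le_one`; no cut-offs at tubes. Tree: `TorusPairDist`; the product inequality is the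
`[0,1]`-valued twin of `Literature.Barriers.Parity.TaoTeravainen.abs_prod_sub_prod_le` (reproved here to
keep the import graph topical).

## References

* E. H. Lieb, R. Seiringer, J. P. Solovej, J. Yngvason, *The Mathematics of the Bose Gas and its
  Condensation*, Birkhäuser (2005), Ch. 2 (hard-core trial states vanishing near the tubes).
* V. Maz'ya, *Sobolev Spaces*, 2nd ed. (2011), §2.3.3.
-/

noncomputable section

open Set Function UnitAddTorus

namespace Literature.Analysis.FunctionSpaces

/-! ## Products of `[0, 1]`-valued reals -/

/-- `|∏ aₗ - ∏ bₗ| ≤ ∑ |aₗ - bₗ|` for factors in `[0, 1]`. [folklore] -/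
theorem abs_prod_sub_prod_le_sum {ι : Type*} (s : Finset ι) {a b : ι → ℝ}
    (ha0 : ∀ i ∈ s, 0 ≤ a i) (ha1 : ∀ i ∈ s, a i ≤ 1) (hb0 : ∀ i ∈ s, 0 ≤ b i) (hb1 : ∀ i ∈ s, b i ≤ 1) :
    |∏ i ∈ s, a i - ∏ i ∈ s, b i| ≤ ∑ i ∈ s, |a i - b i| := by
  classical
  -- adapted from Literature/Barriers/Parity/SiegelZeroDichotomyChowlaModel.lean (`abs_prod_sub_prod_le`)
  induction s using Finset.induction_on with
  | empty => simp
  | insert j s hj ih =>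
    rw [Finset.prod_insert hj, Finset.prod_insert hj, Finset.sum_insert hj]
    have hm : ∀ {c : ι → ℝ}, (∀ i ∈ insert j s, 0 ≤ c i) → ∀ i ∈ s, 0 ≤ c i :=
      fun h i hi => h i (Finset.mem_insert_of_mem hi)
    have hm' : ∀ {c : ι → ℝ}, (∀ i ∈ insert j s, c i ≤ 1) → ∀ i ∈ s, c i ≤ 1 :=
      fun h i hi => h i (Finset.mem_insert_of_mem hi)
    have hbj : |∏ i ∈ s, b i| ≤ 1 := by
      rw [abs_of_nonneg (Finset.prod_nonneg (hm hb0))]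
      exact Finset.prod_le_one (hm hb0) (hm' hb1)
    have haj : |a j| ≤ 1 := by
      rw [abs_of_nonneg (ha0 j (Finset.mem_insert_self j s))]
      exact ha1 j (Finset.mem_insert_self j s)
    have h : a j * ∏ i ∈ s, a i - b j * ∏ i ∈ s, b i
        = a j * (∏ i ∈ s, a i - ∏ i ∈ s, b i) + (a j - b j) * ∏ i ∈ s, b i := by ring
    calc |a j * ∏ i ∈ s, a i - b j * ∏ i ∈ s, b i|
        = |a j * (∏ i ∈ s, a i - ∏ i ∈ s, b i) + (a j - b j) * ∏ i ∈ s, b i| := by rw [h]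
      _ ≤ |a j * (∏ i ∈ s, a i - ∏ i ∈ s, b i)| + |(a j - b j) * ∏ i ∈ s, b i| := abs_add_le _ _
      _ ≤ 1 * |∏ i ∈ s, a i - ∏ i ∈ s, b i| + |a j - b j| * 1 := by
          rw [abs_mul, abs_mul]
          gcongr
      _ ≤ |a j - b j| + ∑ i ∈ s, |a i - b i| := by
          linarith [ih (hm ha0) (hm' ha1) (hm hb0) (hm' hb1)]

namespace Torus

/-! ## Cut profiles -/

/-- **A cut profile with Lipschitz constant `K`**: `θ : ℝ → [0, 1]`, `θ = 0` on `(-∞, 1]`, `θ = 1` on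
`[2, ∞)`, `K`-Lipschitz. [folklore] -/
structure IsCutProfile (K : NNReal) (θ : ℝ → ℝ) : Prop where
  /-- `0 ≤ θ`. -/
  nonneg : ∀ u, 0 ≤ θ u
  /-- `θ ≤ 1`. -/
  le_one : ∀ u, θ u ≤ 1
  /-- `θ(u) = 0` for `u ≤ 1`. -/
  of_le_one : ∀ u, u ≤ 1 → θ u = 0
  /-- `θ(u) = 1` for `2 ≤ u`. -/
  of_two_le : ∀ u, 2 ≤ u → θ u = 1
  /-- `θ` is `K`-Lipschitz. -/
  lipschitz : LipschitzWith K θ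

namespace IsCutProfile

variable {K : NNReal} {θ : ℝ → ℝ}

/-- `|θ(u) - θ(v)| ≤ K |u - v|`. [folklore] -/
theorem abs_sub_le (h : IsCutProfile K θ) (u v : ℝ) : |θ u - θ v| ≤ K * |u - v| := by
  have h1 := h.lipschitz.dist_le_mul u v
  rwa [Real.dist_eq, Real.dist_eq] at h1

/-- A cut profile is continuous. [folklore] -/
theorem continuous (h : IsCutProfile K θ) : Continuous θ := h.lipschitz.continuous

/-- **Locally constant off the layer**: if `u ∉ (1 - m, 2 + m)` and `|v - u| ≤ m` then `θ(v) = θ(u)`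
(both `0` or both `1`). [folklore] -/
theorem eq_of_not_mem_layer (h : IsCutProfile K θ) {u v m : ℝ} (hv : |v - u| ≤ m)
    (hu : u ≤ 1 - m ∨ 2 + m ≤ u) : θ v = θ u := by
  rcases hu with hu | hu
  · rw [h.of_le_one v (by linarith [(abs_le.1 hv).2]), h.of_le_one u (by linarith [abs_nonneg (v - u)])]
  · rw [h.of_two_le v (by linarith [(abs_le.1 hv).1]), h.of_two_le u (by linarith [abs_nonneg (v - u)])]

end IsCutProfile

/-- **The piecewise linear cut profile** `θ(u) = min 1 (max 0 (u - 1))`: `0` for `u ≤ 1`, `u - 1` on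
`[1, 2]`, `1` for `u ≥ 2`; `1`-Lipschitz. [folklore] -/
def cutProfile (u : ℝ) : ℝ := min 1 (max 0 (u - 1))

/-- `|θ(u) - θ(v)| ≤ |u - v|` for the piecewise linear profile (`min` and `max` with a constant are
`1`-Lipschitz). [folklore] -/
theorem abs_cutProfile_sub_le (u v : ℝ) : |cutProfile u - cutProfile v| ≤ |u - v| := by
  unfold cutProfile
  calc |min 1 (max 0 (u - 1)) - min 1 (max 0 (v - 1))|
      ≤ max |(1 : ℝ) - 1| |max 0 (u - 1) - max 0 (v - 1)| := abs_min_sub_min_le_max _ _ _ _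
    _ = |max (u - 1) 0 - max (v - 1) 0| := by
        rw [sub_self, abs_zero, max_eq_right (abs_nonneg _), max_comm (0 : ℝ) (u - 1), max_comm (0 : ℝ) (v - 1)]
    _ ≤ |u - 1 - (v - 1)| := abs_max_sub_max_le_abs _ _ _
    _ = |u - v| := by ring_nf

/-- The piecewise linear profile is a cut profile with `K = 1`. [folklore] -/
theorem isCutProfile_cutProfile : IsCutProfile 1 cutProfile where
  nonneg u := le_min zero_le_one (le_max_left _ _)
  le_one u := min_le_left _ _
  of_le_one u hu := by rw [cutProfile, max_eq_left (by linarith), min_eq_right zero_le_one]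
  of_two_le u hu := by rw [cutProfile, max_eq_right (by linarith), min_eq_left (by linarith)]
  lipschitz := LipschitzWith.of_dist_le_mul fun u v => by
    rw [NNReal.coe_one, one_mul, Real.dist_eq, Real.dist_eq]
    exact abs_cutProfile_sub_le u v

/-- **The smooth cut profile** `θ(u) = smoothTransition(u - 1)` (Mathlib's `C^∞` transition from `0`
on `(-∞, 0]` to `1` on `[1, ∞)`, shifted to the layer `[1, 2]`). [folklore] -/
def smoothCutProfile (u : ℝ) : ℝ := Real.smoothTransition (u - 1)

/-- The smooth cut profile is `C^∞`. [folklore] -/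
theorem contDiff_smoothCutProfile {n : ℕ∞} : ContDiff ℝ n smoothCutProfile :=
  Real.smoothTransition.contDiff.comp (contDiff_id.sub contDiff_const)

/-- **The smooth cut profile is a cut profile** for some Lipschitz constant `K` (its derivative is
continuous and vanishes off `[1, 2]`, hence bounded; mean value theorem). [folklore] -/
theorem exists_isCutProfile_smoothCutProfile : ∃ K : NNReal, IsCutProfile K smoothCutProfile := by
  have hd : Differentiable ℝ smoothCutProfile := (contDiff_smoothCutProfile (n := 1)).differentiable one_ne_zero
  have hc : Continuous (deriv smoothCutProfile) :=
    (contDiff_smoothCutProfile (n := 1)).continuous_deriv le_rfl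
  -- the derivative vanishes off `[1, 2]`
  have hzero : ∀ u, u ∉ Set.Icc (1 : ℝ) 2 → deriv smoothCutProfile u = 0 := by
    intro u hu
    rw [Set.mem_Icc, not_and_or, not_le, not_le] at hu
    rcases hu with hu | hu
    · have hev : smoothCutProfile =ᶠ[nhds u] fun _ => 0 := by
        filter_upwards [Iio_mem_nhds hu] with w hw
        exact Real.smoothTransition.zero_of_nonpos (by simp only [Set.mem_Iio] at hw; linarith)
      rw [hev.deriv_eq, deriv_const]
    · have hev : smoothCutProfile =ᶠ[nhds u] fun _ => 1 := by
        filter_upwards [Ioi_mem_nhds hu] with w hw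
        exact Real.smoothTransition.one_of_one_le (by simp only [Set.mem_Ioi] at hw; linarith)
      rw [hev.deriv_eq, deriv_const]
  obtain ⟨C, hC⟩ := isCompact_Icc.exists_bound_of_continuousOn (hc.continuousOn (s := Set.Icc (1 : ℝ) 2))
  have hC0 : 0 ≤ C := (norm_nonneg _).trans (hC 1 ⟨le_rfl, by norm_num⟩)
  refine ⟨⟨C, hC0⟩, ?_⟩
  exact
    { nonneg := fun u => Real.smoothTransition.nonneg _
      le_one := fun u => Real.smoothTransition.le_one _
      of_le_one := fun u hu => Real.smoothTransition.zero_of_nonpos (by linarith)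
      of_two_le := fun u hu => Real.smoothTransition.one_of_one_le (by linarith)
      lipschitz := lipschitzWith_of_nnnorm_deriv_le hd fun u => by
        by_cases hu : u ∈ Set.Icc (1 : ℝ) 2
        · rw [← NNReal.coe_le_coe, coe_nnnorm]
          exact hC u hu
        · rw [hzero u hu, nnnorm_zero]
          exact zero_le }

/-! ## The product cut-off near the pair tubes -/

variable {N : ℕ} {K : NNReal} {θ : ℝ → ℝ}

/-- **The cut-off near the hard-core pair tubes** of radius `r` at scale `δ` with profile `θ`:
`χ(t) = ∏_{i<j} θ((ρᵢⱼ(t) - r)/δ)`, `ρᵢⱼ = pairDist i j`. For a cut profile `θ` it vanishes where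
some `ρᵢⱼ ≤ r + δ` and equals `1` where all `ρᵢⱼ ≥ r + 2δ`. [folklore] -/
def pairCutoff (θ : ℝ → ℝ) (r δ : ℝ) (t : UnitAddTorus (Fin N × Fin 3)) : ℝ :=
  ∏ q ∈ (Finset.univ : Finset (Fin N × Fin N)).filter (fun q => q.1 < q.2),
    θ ((pairDist q.1 q.2 t - r) / δ)

/-- `0 ≤ χ`. [folklore] -/
theorem pairCutoff_nonneg (hθ : IsCutProfile K θ) (r δ : ℝ) (t : UnitAddTorus (Fin N × Fin 3)) : 0 ≤ pairCutoff θ r δ t :=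
  Finset.prod_nonneg fun _ _ => hθ.nonneg _

/-- `χ ≤ 1`. [folklore] -/
theorem pairCutoff_le_one (hθ : IsCutProfile K θ) (r δ : ℝ) (t : UnitAddTorus (Fin N × Fin 3)) : pairCutoff θ r δ t ≤ 1 :=
  Finset.prod_le_one (fun _ _ => hθ.nonneg _) fun _ _ => hθ.le_one _

/-- `|χ| ≤ 1`. [folklore] -/
theorem abs_pairCutoff_le_one (hθ : IsCutProfile K θ) (r δ : ℝ) (t : UnitAddTorus (Fin N × Fin 3)) :
    |pairCutoff θ r δ t| ≤ 1 := by
  rw [abs_of_nonneg (pairCutoff_nonneg hθ r δ t)]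
  exact pairCutoff_le_one hθ r δ t

/-- `χ` is continuous. [folklore] -/
theorem continuous_pairCutoff (hθ : IsCutProfile K θ) (r δ : ℝ) : Continuous (pairCutoff (N := N) θ r δ) := by
  unfold pairCutoff
  refine continuous_finsetProd _ fun q _ => ?_
  exact hθ.continuous.comp (((continuous_pairDist q.1 q.2).sub continuous_const).div_const δ)

/-- **`χ` vanishes within `δ` of a tube**: if `i < j` and `ρᵢⱼ(t) ≤ r + δ` (`0 < δ`) then `χ(t) = 0`.
[folklore] -/
theorem pairCutoff_eq_zero (hθ : IsCutProfile K θ) {r δ : ℝ} (hδ : 0 < δ) {t : UnitAddTorus (Fin N × Fin 3)}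
    {i j : Fin N} (hij : i < j) (ht : pairDist i j t ≤ r + δ) : pairCutoff θ r δ t = 0 := by
  unfold pairCutoff
  refine Finset.prod_eq_zero (i := (i, j)) (Finset.mem_filter.2 ⟨Finset.mem_univ _, hij⟩) ?_
  exact hθ.of_le_one _ (by rw [div_le_one hδ]; linarith)

/-- The symmetric form: `i ≠ j` and `ρᵢⱼ(t) ≤ r + δ` force `χ(t) = 0`. [folklore] -/
theorem pairCutoff_eq_zero_of_ne (hθ : IsCutProfile K θ) {r δ : ℝ} (hδ : 0 < δ) {t : UnitAddTorus (Fin N × Fin 3)}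
    {i j : Fin N} (hij : i ≠ j) (ht : pairDist i j t ≤ r + δ) : pairCutoff θ r δ t = 0 := by
  rcases lt_or_gt_of_ne hij with h | h
  · exact pairCutoff_eq_zero hθ hδ h ht
  · exact pairCutoff_eq_zero hθ hδ h (by rwa [pairDist_comm])

/-- **`χ = 1` away from the tubes**: if `ρᵢⱼ(t) ≥ r + 2δ` for all `i < j` (`0 < δ`) then `χ(t) = 1`.
[folklore] -/
theorem pairCutoff_eq_one (hθ : IsCutProfile K θ) {r δ : ℝ} (hδ : 0 < δ) {t : UnitAddTorus (Fin N × Fin 3)}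
    (ht : ∀ i j : Fin N, i < j → r + 2 * δ ≤ pairDist i j t) : pairCutoff θ r δ t = 1 := by
  unfold pairCutoff
  refine Finset.prod_eq_one fun q hq => hθ.of_two_le _ ?_
  rw [le_div_iff₀ hδ]
  linarith [ht q.1 q.2 (Finset.mem_filter.1 hq).2]

/-! ## The directional Lipschitz modulus of the cut-off -/

/-- One factor along a coordinate line of particle `i`: for the pair `(i, j)`, `i ≠ j`, `0 < δ`,
`|θ((ρᵢⱼ(t + s𝐞_{(i,k)}) - r)/δ) - θ((ρᵢⱼ(t) - r)/δ)| ≤ K|s|/δ`, and the difference vanishes unless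
`r + δ - |s| < ρᵢⱼ(t) < r + 2δ + |s|`. [folklore] -/
theorem abs_profile_pair_add_single_sub_le (hθ : IsCutProfile K θ) {r δ : ℝ} (hδ : 0 < δ) {i j : Fin N}
    (hij : i ≠ j) (t : UnitAddTorus (Fin N × Fin 3)) (k : Fin 3) (s : ℝ) :
    |θ ((pairDist i j (t + Pi.single (i, k) ((s : ℝ) : UnitAddCircle)) - r) / δ) -
        θ ((pairDist i j t - r) / δ)| ≤
      if r + δ - |s| < pairDist i j t ∧ pairDist i j t < r + 2 * δ + |s| then K * (|s| / δ) else 0 := by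
  have hL := abs_pairDist_add_single_sub_le hij t k s
  have hdiff : |(pairDist i j (t + Pi.single (i, k) ((s : ℝ) : UnitAddCircle)) - r) / δ - (pairDist i j t - r) / δ| ≤
      |s| / δ := by
    rw [← sub_div, abs_div, abs_of_pos hδ, div_le_div_iff_of_pos_right hδ]
    have : pairDist i j (t + Pi.single (i, k) ((s : ℝ) : UnitAddCircle)) - r - (pairDist i j t - r) =
        pairDist i j (t + Pi.single (i, k) ((s : ℝ) : UnitAddCircle)) - pairDist i j t := by ring
    rw [this]
    exact hL
  split_ifs with h
  · exact (hθ.abs_sub_le _ _).trans (mul_le_mul_of_nonneg_left hdiff K.coe_nonneg)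
  · rw [abs_nonpos_iff, sub_eq_zero]
    refine hθ.eq_of_not_mem_layer (m := |s| / δ) hdiff ?_
    rw [not_and_or, not_lt, not_lt] at h
    rcases h with h | h
    · left
      rw [div_le_iff₀ hδ, sub_mul, div_mul_cancel₀ _ hδ.ne', one_mul]
      linarith
    · right
      rw [le_div_iff₀ hδ, add_mul, div_mul_cancel₀ _ hδ.ne']
      linarith

/-- The same for the pair written `(j, i)` (the moved particle second). [folklore] -/
theorem abs_profile_pair_add_single_sub_le' (hθ : IsCutProfile K θ) {r δ : ℝ} (hδ : 0 < δ) {i j : Fin N}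
    (hij : i ≠ j) (t : UnitAddTorus (Fin N × Fin 3)) (k : Fin 3) (s : ℝ) :
    |θ ((pairDist j i (t + Pi.single (i, k) ((s : ℝ) : UnitAddCircle)) - r) / δ) -
        θ ((pairDist j i t - r) / δ)| ≤
      if r + δ - |s| < pairDist j i t ∧ pairDist j i t < r + 2 * δ + |s| then K * (|s| / δ) else 0 := by
  simpa only [pairDist_comm j i] using abs_profile_pair_add_single_sub_le (r := r) hθ hδ hij t k s

/-- **Directional Lipschitz modulus of the cut-off.** For a cut profile `θ` with constant `K`, `0 < δ`,
a particle `i`, a coordinate `k` and a real `s`,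
`|χ(t + s𝐞_{(i,k)}) - χ(t)| ≤ (K|s|/δ) · 2 · #{j : r + δ - |s| < ρᵢⱼ(t) < r + 2δ + |s|}`
(written as a sum of indicators over all `j`): only the pairs containing `i` move, each by at most
`K|s|/δ` and only inside its enlarged transition layer. [folklore] -/
theorem abs_pairCutoff_add_single_sub_le (hθ : IsCutProfile K θ) {r δ : ℝ} (hδ : 0 < δ) (i : Fin N)
    (t : UnitAddTorus (Fin N × Fin 3)) (k : Fin 3) (s : ℝ) :
    |pairCutoff θ r δ (t + Pi.single (i, k) ((s : ℝ) : UnitAddCircle)) - pairCutoff θ r δ t| ≤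
      K * (|s| / δ) * (2 * ∑ j : Fin N,
        if r + δ - |s| < pairDist i j t ∧ pairDist i j t < r + 2 * δ + |s| then (1 : ℝ) else 0) := by
  classical
  set t' : UnitAddTorus (Fin N × Fin 3) := t + Pi.single (i, k) ((s : ℝ) : UnitAddCircle) with ht'
  set P : Finset (Fin N × Fin N) := (Finset.univ : Finset (Fin N × Fin N)).filter (fun q => q.1 < q.2) with hP
  set G : Fin N → ℝ := fun j =>
    if r + δ - |s| < pairDist i j t ∧ pairDist i j t < r + 2 * δ + |s| then (1 : ℝ) else 0 with hG
  have hG0 : ∀ j, 0 ≤ G j := fun j => by simp only [hG]; split_ifs <;> norm_num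
  -- the per-pair bound `F q`
  set F : Fin N × Fin N → ℝ := fun q =>
    (if q.1 = i then K * (|s| / δ) * G q.2 else 0) + if q.2 = i then K * (|s| / δ) * G q.1 else 0 with hF
  have hsδ : 0 ≤ K * (|s| / δ) := mul_nonneg K.coe_nonneg (div_nonneg (abs_nonneg _) hδ.le)
  have hfac : ∀ q ∈ P, |θ ((pairDist q.1 q.2 t' - r) / δ) - θ ((pairDist q.1 q.2 t - r) / δ)| ≤ F q := by
    intro q hq
    have hq12 : q.1 ≠ q.2 := (Finset.mem_filter.1 hq).2.ne
    by_cases h1 : q.1 = i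
    · -- the pair `(i, q.2)`
      have hne : i ≠ q.2 := h1 ▸ hq12
      have h2 : q.2 ≠ i := fun h => hq12 (h1.trans h.symm)
      have hb := abs_profile_pair_add_single_sub_le (r := r) hθ hδ hne t k s
      simp only [hF, if_pos h1, if_neg h2, add_zero, hG]
      rw [h1]
      refine hb.trans ?_
      split_ifs <;> simp
    · by_cases h2 : q.2 = i
      · -- the pair `(q.1, i)`
        have hne : i ≠ q.1 := fun h => h1 h.symm
        have hb := abs_profile_pair_add_single_sub_le' (r := r) hθ hδ hne t k s
        simp only [hF, if_neg h1, if_pos h2, zero_add, hG]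
        rw [h2, pairDist_comm i q.1]
        refine hb.trans ?_
        split_ifs <;> simp
      · -- a pair not containing `i`
        have hl1 : i ≠ q.1 := fun h => h1 h.symm
        have hl2 : i ≠ q.2 := fun h => h2 h.symm
        simp only [hF, if_neg h1, if_neg h2, add_zero, ht']
        rw [pairDist_add_single_of_ne hl1 hl2, sub_self, abs_zero]
  have hF0 : ∀ q, 0 ≤ F q := fun q => by
    simp only [hF]
    refine add_nonneg ?_ ?_ <;> split_ifs <;> first | exact mul_nonneg hsδ (hG0 _) | exact le_rfl
  -- the two halves of `∑ F`
  have hA : ∑ q : Fin N × Fin N, (if q.1 = i then K * (|s| / δ) * G q.2 else 0) = ∑ j, K * (|s| / δ) * G j := by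
    rw [Fintype.sum_prod_type, Finset.sum_comm]
    refine Finset.sum_congr rfl fun b _ => ?_
    simp only [Finset.sum_ite_eq', Finset.mem_univ, if_true]
  have hB : ∑ q : Fin N × Fin N, (if q.2 = i then K * (|s| / δ) * G q.1 else 0) = ∑ j, K * (|s| / δ) * G j := by
    rw [Fintype.sum_prod_type]
    refine Finset.sum_congr rfl fun a _ => ?_
    simp only [Finset.sum_ite_eq', Finset.mem_univ, if_true]
  calc |pairCutoff θ r δ t' - pairCutoff θ r δ t|
      ≤ ∑ q ∈ P, |θ ((pairDist q.1 q.2 t' - r) / δ) - θ ((pairDist q.1 q.2 t - r) / δ)| :=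
        abs_prod_sub_prod_le_sum P (fun _ _ => hθ.nonneg _) (fun _ _ => hθ.le_one _)
          (fun _ _ => hθ.nonneg _) (fun _ _ => hθ.le_one _)
    _ ≤ ∑ q ∈ P, F q := Finset.sum_le_sum hfac
    _ ≤ ∑ q : Fin N × Fin N, F q :=
        Finset.sum_le_sum_of_subset_of_nonneg (Finset.filter_subset _ _) fun q _ _ => hF0 q
    _ = K * (|s| / δ) * (2 * ∑ j : Fin N, G j) := by
        simp only [hF, Finset.sum_add_distrib, hA, hB, ← Finset.mul_sum]
        ring

end Torus

end Literature.Analysis.FunctionSpaces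

end
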